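import Summits.ABC.ABC.Theorems.TwistAmplificationSharpModerateLawTwistMinimalInversion
import Summits.ABC.ABC.Theorems.TwistAmplificationSharpModerateLawTwistMinimalDecomposition
import Summits.ABC.ABC.Theorems.TwistAmplificationSharpModerateLawTwistMinimalScaling
import Summits.ABC.ABC.Theorems.TwistAmplificationSharpModerateLawTwistMinimalPointwise

/-!
# Crux `TwistAmplification.SharpModerateLaw` (stmt-ABC-1975): the twist-orbit inversion, assembled

Lead `prover-line-stmt-ABC-1975-c6-0`, skeleton v5.1 (line `unit-plane-conic-two-torsion`, reshaped into the twist-orbit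
inversion of the canonical core `CoreLaw`). This file composes the LANDED provable stubs of the skeleton BY NAME and records
what the crux costs beyond the summit as tree theorems:

* `twistOrbitInversion_holds : TwistOrbitInversion` — `CoreLawTM → PointwiseSzpiroCusp → CoreLaw`
  (`stub_inversion stub_twistDecomposition stub_twistScaling`; files `…TwistMinimalInversion.lean` p140703,
  `…TwistMinimalDecomposition.lean` p138250, `…TwistMinimalScaling.lean` p138452);
* `coreLaw_iff_coreLawTM_and_abc : CoreLaw ↔ (CoreLawTM ∧ ABC)` — the canonical core of the crux IS the core law on
  twist-minimal pairs plus the summit (`coreLawTM_of_coreLaw`, `abc_of_coreLaw`, `pointwiseSzpiroCusp_of_abc` p140040);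
* `coreLaw_iff_coreLawTM_and_pointwiseSzpiroCusp : CoreLaw ↔ (CoreLawTM ∧ PointwiseSzpiroCusp)`;
* `sharpModerateLaw_of_coreLawTM_of_pointwiseSzpiroCusp` — the skeleton's composition with its two RESIDUAL stubs as
  hypotheses: the crux from `CoreLawTM` and `PointwiseSzpiroCusp` (everything else in skeleton v5 is proved);
* `sharpModerateLaw_of_abc_of_coreLawTM : ABC → CoreLawTM → SharpModerateLaw` and
  `sharpModerateLaw_iff_abc_of_coreLawTM : CoreLawTM → (SharpModerateLaw ↔ ABC)` — granted the twist-minimal statistics,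
  the crux is EXACTLY the summit (`abc_of_sharpModerateLaw` is the landed converse).
-/

noncomputable section

-- the mandated summit namespace `Summit.ABC.ABC` (summit = problem) trips the duplicate-namespace linter
set_option linter.dupNamespace false

namespace Summit.ABC.ABC.Theorems.SharpModerateLaw

/-- **The twist-orbit inversion holds**: `CoreLawTM → PointwiseSzpiroCusp → CoreLaw` (the three landed provable stubs of
skeleton v5 composed by name). -/
theorem twistOrbitInversion_holds : TwistOrbitInversion :=
  stub_inversion stub_twistDecomposition stub_twistScaling

/-- `CoreLaw` from the two residual summands. -/
theorem coreLaw_of_coreLawTM_of_pointwiseSzpiroCusp (hTM : CoreLawTM) (hPW : PointwiseSzpiroCusp) : CoreLaw :=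
  twistOrbitInversion_holds hTM hPW

/-- **`CoreLaw ↔ CoreLawTM ∧ PointwiseSzpiroCusp`**: the canonical core splits into its statistical and its pointwise
summand (`→`: a sub-count, and `CoreLaw → ABC → PointwiseSzpiroCusp`; `←`: the inversion). -/
theorem coreLaw_iff_coreLawTM_and_pointwiseSzpiroCusp : CoreLaw ↔ (CoreLawTM ∧ PointwiseSzpiroCusp) :=
  ⟨fun h => ⟨coreLawTM_of_coreLaw h, pointwiseSzpiroCusp_of_abc (abc_of_coreLaw h)⟩,
    fun h => coreLaw_of_coreLawTM_of_pointwiseSzpiroCusp h.1 h.2⟩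

/-- **`CoreLaw ↔ CoreLawTM ∧ ABC`**: the canonical core of the crux is the core law on twist-minimal pairs plus the
summit. -/
theorem coreLaw_iff_coreLawTM_and_abc : CoreLaw ↔ (CoreLawTM ∧ _root_.ABC) :=
  ⟨fun h => ⟨coreLawTM_of_coreLaw h, abc_of_coreLaw h⟩,
    fun h => coreLaw_of_coreLawTM_of_pointwiseSzpiroCusp h.1 (pointwiseSzpiroCusp_of_abc h.2)⟩

/-- **Skeleton v5 closed modulo its two residual stubs**: the crux from `CoreLawTM` (statistical, open) and
`PointwiseSzpiroCusp` (pointwise, `↔ ABC`), through the landed inversion and `sharpModerateLaw_of_coreLaw`. -/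
theorem sharpModerateLaw_of_coreLawTM_of_pointwiseSzpiroCusp (hTM : CoreLawTM) (hPW : PointwiseSzpiroCusp) :
    Summit.ABC.ABC.Theses.TwistAmplification.SharpModerateLaw :=
  sharpModerateLaw_of_coreLaw (coreLaw_of_coreLawTM_of_pointwiseSzpiroCusp hTM hPW)

/-- **`ABC → CoreLawTM → SharpModerateLaw`**: the summit and the twist-minimal statistics give the crux. -/
theorem sharpModerateLaw_of_abc_of_coreLawTM (hABC : _root_.ABC) (hTM : CoreLawTM) :
    Summit.ABC.ABC.Theses.TwistAmplification.SharpModerateLaw :=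
  sharpModerateLaw_of_coreLawTM_of_pointwiseSzpiroCusp hTM (pointwiseSzpiroCusp_of_abc hABC)

/-- **Granted `CoreLawTM`, the crux is exactly the summit**: `SharpModerateLaw ↔ ABC`
(`abc_of_sharpModerateLaw`, `sharpModerateLaw_of_abc_of_coreLawTM`). -/
theorem sharpModerateLaw_iff_abc_of_coreLawTM (hTM : CoreLawTM) :
    Summit.ABC.ABC.Theses.TwistAmplification.SharpModerateLaw ↔ _root_.ABC :=
  ⟨Summit.ABC.ABC.Theorems.abc_of_sharpModerateLaw, fun h => sharpModerateLaw_of_abc_of_coreLawTM h hTM⟩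

end Summit.ABC.ABC.Theorems.SharpModerateLaw

end
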